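import Summits.ValiantsHypothesis.ValiantsHypothesis.Theorems.BarrierLeverPartitionMinorsHitByVPBinaryContiguous

/-!
# Route BarrierLever — item `PartitionMinorsHitByVP` (stmt-ValiantsHypothesis-19717):
# ALL row families × `p`-ARY-CONTIGUOUS column families are hit (Frobenius tables in every characteristic)

Helper file (`--supports stmt-ValiantsHypothesis-19717`; cell valiant-natproofs, rung V4, 𝒟-side door (c),
prover seat val-np-p1, gen 10). Closes NO item; definition-free. The odd-prime companion of
`…PartitionMinorsHitByVPBinaryContiguous`: the reduction works modulo EVERY prime `p`, with the Frobenius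
table `X_(c,none) ↦ [c ∈ Z]`, `X_(c,some a) ↦ [c ∉ Z]·t^(a·p^{e c})` in `𝔽_p[t]`
(`(Σ_{a∈U} t^a)^(p^k) = Σ_{a∈U} t^(a·p^k)`), so the integer additive matrix
`[∏_{c ∈ w j} (X_(c,none) + Σ_{a ∈ u i} X_(c,some a))]_{i,j}` evaluates to the Vandermonde matrix of the distinct
code polynomials `ξ_{u i} = Σ_{a ∈ u i} t^a` with columns permuted, as soon as the `p`-ARY WEIGHTS
`Σ_{c ∈ w j \ Z} p^{e c}` are exactly `0, 1, …, r−1` in some order.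

**Theorem (`partitionMinor_hit_of_primaryContiguous`).** `h ≥ 2`, `p` prime; rows `u : Fin r → Finset (Fin h)`
injective and otherwise ARBITRARY; columns `w` with `Σ_{c ∈ w j \ Z} p^{e c} = σ j` for a weight
`e : Fin h → ℕ`, a neutral set `Z` and a permutation `σ` of `Fin r`. Then
`∃ f ∈ SmallCircuits ℂ (h+h) 5`, `det [coeff_{x^{u i} y^{w j}} f] ≠ 0`. Mirror `…_rows`.

New examples beyond `p = 2` (faces): with `e` constant on blocks `B₀, B₁, …` of `p − 1` coordinates each
(`e = k` on `B_k`) the weight is the base-`p` number with digits `|w j ∩ B_k|`, so every TRANSVERSAL family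
«one column set per digit vector» — e.g. PRODUCTS OF SATURATED CHAINS `{∅ ⊂ {a_k} ⊂ {a_k, b_k}}` over `m`
disjoint pairs (`p = 3`, `r = 3^m`), which are neither faces nor chains — is hit against every row family of
the same size.

WHAT THIS IS NOT: weights that are distinct but not an initial segment give generalized Vandermonde matrices
(Schur factors may vanish mod `p`); the additive door does not reach all layouts; item 19717 stays open; nothing
on CPM (20172/20195), crux 14610 or VP vs VNP.
-/

set_option linter.dupNamespace false

namespace Summit.ValiantsHypothesis.ValiantsHypothesis.Theorems.BarrierLever.SubsetSum

open Finset MvPolynomial Literature.Barriers.ValiantsHypothesis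
open Summit.ValiantsHypothesis.ValiantsHypothesis.Theorems.BarrierLever.AdditiveDoor
  (partitionMinor_hit_of_additive_mem partitionMinor_hit_symm)

noncomputable section

variable {h : ℕ} {p : ℕ} [Fact p.Prime]

/-! ## 1. Code polynomials over `𝔽_p` -/

/-- The coefficients of the code polynomial `Σ_{k∈U} t^k ∈ 𝔽_p[t]` are the indicator of `U`. -/
theorem coeff_codePolyP (U : Finset (Fin h)) (k : Fin h) :
    (∑ j ∈ U, (Polynomial.X : Polynomial (ZMod p)) ^ (j : ℕ)).coeff (k : ℕ) =
      if k ∈ U then 1 else 0 := by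
  rw [Polynomial.finsetSum_coeff]
  simp_rw [Polynomial.coeff_X_pow, Fin.val_inj]
  exact Finset.sum_ite_eq U k fun _ => 1

/-- The code polynomial over `𝔽_p` is injective in `U`. -/
theorem codePolyP_injective :
    Function.Injective fun U : Finset (Fin h) => ∑ j ∈ U, (Polynomial.X : Polynomial (ZMod p)) ^ (j : ℕ) := by
  intro U V hUV
  ext k
  have := congrArg (fun q => Polynomial.coeff q (k : ℕ)) hUV
  simp only [coeff_codePolyP] at this
  by_cases hU : k ∈ U <;> by_cases hV : k ∈ V <;> simp_all

/-! ## 2. The Frobenius table modulo `p` -/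

/-- Frobenius additivity in characteristic `p` with a neutral set. -/
theorem frobP_lin (Z : Finset (Fin h)) (e : Fin h → ℕ) (c : Fin h) (U : Finset (Fin h)) :
    eval₂Hom (Int.castRingHom (Polynomial (ZMod p)))
        (fun q : Fin h × Option (Fin h) =>
          Option.elim q.2 (if q.1 ∈ Z then 1 else 0) fun a =>
            if q.1 ∈ Z then 0 else (Polynomial.X : Polynomial (ZMod p)) ^ ((a : ℕ) * p ^ e q.1))
        (X (c, none) + ∑ a ∈ U, X (c, some a) : MvPolynomial (Fin h × Option (Fin h)) ℤ) =
      if c ∈ Z then 1 else (∑ j ∈ U, (Polynomial.X : Polynomial (ZMod p)) ^ (j : ℕ)) ^ p ^ e c := by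
  simp only [map_add, map_sum, coe_eval₂Hom, eval₂_X, Option.elim]
  split_ifs with hc
  · simp
  · rw [zero_add, sum_pow_char_pow p (e c) U]
    refine Finset.sum_congr rfl fun k _ => ?_
    rw [← pow_mul]

/-- The evaluated entry is `ξ_U^(Σ_{c ∈ W \ Z} p^{e c})`. -/
theorem frobP_entry (Z : Finset (Fin h)) (e : Fin h → ℕ) (U W : Finset (Fin h)) :
    eval₂Hom (Int.castRingHom (Polynomial (ZMod p)))
        (fun q : Fin h × Option (Fin h) =>
          Option.elim q.2 (if q.1 ∈ Z then 1 else 0) fun a =>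
            if q.1 ∈ Z then 0 else (Polynomial.X : Polynomial (ZMod p)) ^ ((a : ℕ) * p ^ e q.1))
        (∏ c ∈ W, (X (c, none) + ∑ a ∈ U, X (c, some a)) : MvPolynomial (Fin h × Option (Fin h)) ℤ) =
      (∑ j ∈ U, (Polynomial.X : Polynomial (ZMod p)) ^ (j : ℕ)) ^ (∑ c ∈ W \ Z, p ^ e c) := by
  rw [map_prod, ← Finset.prod_pow_eq_pow_sum, Finset.sdiff_eq_filter, Finset.prod_filter]
  refine Finset.prod_congr rfl fun c _ => ?_
  rw [frobP_lin]
  split_ifs <;> rfl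

/-! ## 3. Nonsingularity, a complex table, the door -/

/-- **`p`-ary-contiguous columns × any injective rows: the integer additive matrix is nonsingular.** -/
theorem det_additiveZ_ne_zero_of_primaryContiguous (p : ℕ) [Fact p.Prime] {r : ℕ}
    (u w : Fin r → Finset (Fin h)) (hu : Function.Injective u) (Z : Finset (Fin h)) (e : Fin h → ℕ)
    (σ : Equiv.Perm (Fin r)) (hw : ∀ j, ∑ c ∈ w j \ Z, p ^ e c = (σ j : ℕ)) :
    (Matrix.of fun i j : Fin r =>
      (∏ c ∈ w j, (X (c, none) + ∑ a ∈ u i, X (c, some a)) :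
        MvPolynomial (Fin h × Option (Fin h)) ℤ)).det ≠ 0 := by
  let ψ : MvPolynomial (Fin h × Option (Fin h)) ℤ →+* Polynomial (ZMod p) :=
    eval₂Hom (Int.castRingHom (Polynomial (ZMod p)))
      (fun q : Fin h × Option (Fin h) =>
        Option.elim q.2 (if q.1 ∈ Z then 1 else 0) fun a =>
          if q.1 ∈ Z then 0 else (Polynomial.X : Polynomial (ZMod p)) ^ ((a : ℕ) * p ^ e q.1))
  let ξ : Finset (Fin h) → Polynomial (ZMod p) := fun U =>
    ∑ j ∈ U, (Polynomial.X : Polynomial (ZMod p)) ^ (j : ℕ)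
  have hmat : ψ.mapMatrix (Matrix.of fun i j : Fin r =>
      (∏ c ∈ w j, (X (c, none) + ∑ a ∈ u i, X (c, some a)) :
        MvPolynomial (Fin h × Option (Fin h)) ℤ)) =
      (Matrix.vandermonde fun i : Fin r => ξ (u i)).submatrix id σ := by
    refine Matrix.ext fun i j => ?_
    rw [RingHom.mapMatrix_apply, Matrix.map_apply, Matrix.of_apply, Matrix.submatrix_apply,
      Matrix.vandermonde_apply, id, ← hw j]
    exact frobP_entry Z e (u i) (w j)
  have hV : (Matrix.vandermonde fun i : Fin r => ξ (u i)).det ≠ 0 :=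
    Matrix.det_vandermonde_ne_zero_iff.mpr (codePolyP_injective.comp hu)
  have hdet : (ψ.mapMatrix (Matrix.of fun i j : Fin r =>
      (∏ c ∈ w j, (X (c, none) + ∑ a ∈ u i, X (c, some a)) :
        MvPolynomial (Fin h × Option (Fin h)) ℤ))).det ≠ 0 := by
    rw [hmat, Matrix.det_permute']
    refine mul_ne_zero ?_ hV
    rcases Int.units_eq_one_or (Equiv.Perm.sign σ) with h1 | h1 <;> simp [h1]
  intro h0
  apply hdet
  rw [← RingHom.map_det, h0, map_zero]

/-- **A complex additive table exists** for `p`-ary-contiguous columns × any injective rows. -/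
theorem exists_table_of_primaryContiguous (p : ℕ) [Fact p.Prime] {r : ℕ}
    (u w : Fin r → Finset (Fin h)) (hu : Function.Injective u) (Z : Finset (Fin h)) (e : Fin h → ℕ)
    (σ : Equiv.Perm (Fin r)) (hw : ∀ j, ∑ c ∈ w j \ Z, p ^ e c = (σ j : ℕ)) :
    ∃ (ω₀ : Fin h → ℂ) (ω : Fin h → Fin h → ℂ),
      (Matrix.of fun i j : Fin r => ∏ c ∈ w j, (ω₀ c + ∑ a ∈ u i, ω a c)).det ≠ 0 := by
  set P : MvPolynomial (Fin h × Option (Fin h)) ℤ := (Matrix.of fun i j : Fin r =>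
      (∏ c ∈ w j, (X (c, none) + ∑ a ∈ u i, X (c, some a)) :
        MvPolynomial (Fin h × Option (Fin h)) ℤ)).det with hP
  have hPne : P ≠ 0 := det_additiveZ_ne_zero_of_primaryContiguous p u w hu Z e σ hw
  have hPC : MvPolynomial.map (Int.castRingHom ℂ) P ≠ 0 := fun h0 =>
    hPne (MvPolynomial.map_injective (Int.castRingHom ℂ) Int.cast_injective (by rw [h0, map_zero]))
  have : ∃ x : Fin h × Option (Fin h) → ℂ, eval x (MvPolynomial.map (Int.castRingHom ℂ) P) ≠ 0 := by
    by_contra hcon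
    push Not at hcon
    exact hPC (MvPolynomial.funext fun x => by rw [hcon x, map_zero])
  obtain ⟨x, hx⟩ := this
  refine ⟨fun c => x (c, none), fun a c => x (c, some a), ?_⟩
  rw [MvPolynomial.eval_map, ← coe_eval₂Hom, hP, RingHom.map_det] at hx
  convert hx using 2
  refine Matrix.ext fun i j => ?_
  simp only [Matrix.of_apply, RingHom.mapMatrix_apply, Matrix.map_apply, map_prod, map_add, map_sum,
    eval₂Hom_X']

/-- **ALL rows × `p`-ARY-CONTIGUOUS columns are hit** (`h ≥ 2`, `b = 5`, any prime `p`). -/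
theorem partitionMinor_hit_of_primaryContiguous (hh : 2 ≤ h) (p : ℕ) [Fact p.Prime] {r : ℕ}
    (u w : Fin r → Finset (Fin h)) (hu : Function.Injective u) (Z : Finset (Fin h)) (e : Fin h → ℕ)
    (σ : Equiv.Perm (Fin r)) (hw : ∀ j, ∑ c ∈ w j \ Z, p ^ e c = (σ j : ℕ)) :
    ∃ f ∈ SmallCircuits ℂ (h + h) 5,
      (Matrix.of fun i j : Fin r => MvPolynomial.coeff
        (∑ a ∈ u i, Finsupp.single (Fin.castAdd h a) 1 +
          ∑ c ∈ w j, Finsupp.single (Fin.natAdd h c) 1) f).det ≠ 0 := by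
  obtain ⟨ω₀, ω, hdet⟩ := exists_table_of_primaryContiguous p u w hu Z e σ hw
  exact partitionMinor_hit_of_additive_mem h hh u w ω₀ ω hdet

/-- **`p`-ARY-CONTIGUOUS rows × ALL columns are hit** (`x ↔ y` mirror). -/
theorem partitionMinor_hit_of_primaryContiguous_rows (hh : 2 ≤ h) (p : ℕ) [Fact p.Prime] {r : ℕ}
    (u w : Fin r → Finset (Fin h)) (hw : Function.Injective w) (Z : Finset (Fin h)) (e : Fin h → ℕ)
    (σ : Equiv.Perm (Fin r)) (hu : ∀ i, ∑ c ∈ u i \ Z, p ^ e c = (σ i : ℕ)) :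
    ∃ f ∈ SmallCircuits ℂ (h + h) 5,
      (Matrix.of fun i j : Fin r => MvPolynomial.coeff
        (∑ a ∈ u i, Finsupp.single (Fin.castAdd h a) 1 +
          ∑ c ∈ w j, Finsupp.single (Fin.natAdd h c) 1) f).det ≠ 0 :=
  partitionMinor_hit_symm h 5 u w (partitionMinor_hit_of_primaryContiguous hh p w u hw Z e σ hu)

end

end Summit.ValiantsHypothesis.ValiantsHypothesis.Theorems.BarrierLever.SubsetSum
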